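import Summits.Schanuel.Schanuel.Theorems.RootDecomp1KGeneric18

/-!
# RootDecomp1ETwoScale — lens 2, generation 37 «TWO-SCALE E-PLANES» (items 25020 / 31409 of route 1E at n = 4 on `InTwoScaleClass`, mod NW96 Thm 1) — part 1 (RootDecomp1ETwoScale01): §1 the poly-log towers `ptower d = Σ_k 2^{−2^{d^k}}`: partial sums, tails, denominators, the covering/approximation lemmas

PORT NOTE (census-1 gen 16, 2026-08-31): port of [HOME/decomp-schanuel-lens-2/g37/TwoScale.lean v2 sha256 e81e28b8…d084, 2853 l (v1 df3b5e32…, 2509 l + §5b); own farm rc 0 · 0 warn · 0 sorry · axioms std; critic VERDICT STATUS L1776 (credit E-R17, PORT GO), v2 ACK L1780].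
Nine parts `RootDecomp1ETwoScale01`–`09` following the lens's PORT PLAN (NODE-g37.md §5) and the critic's terms (VERDICT L1776: engine §§1–4 as
ONE-ENGINE modules with NO 1E vocabulary and NO Theses import, `(hNW : NesterenkoWaldschmidt1996_thm_1)` kept BY NAME with the `K = 0 ∨ …` disjunction
as typed, the two `maxHeartbeats 1600000 in` lines carried as-is, links + separation in the §5 part): 01 = §1 the poly-log towers `ptower d`, 02 = §2 the
classes `LogPowLiouville p` / `CoveredTower` and the tower members, 03 = §3 measure helpers (section `Measure`: root package, `aeval_ne_zero_of_len_lt_den`,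
`pair_lower_bound`), 04 = `clash_at_scale` + `const_term_lower_bound`, 05 = (E2) `towerPair_measure` + §4 `FamMeasure` / `exists_trim` / `famMeasure_tower`,
06 = (T2) `kernel_sum_ne_zero` … `algebraicIndependent_sigma`, 07 = `exists_int_relation₂` + (E3) `algebraicIndependent_two_scale` / `algebraicIndependent_tower_sigma`,
08 = §5 cells `defectOneSchanuel_twoScaleCell` / `eStableDefectOne_twoScaleCell` (LIVE item texts at n := 4 + ONE class line), positional links `…_of_item`,
members `zTS = (T₀, iT₀, σ₀, iσ₀)`, items APPLIED / instances mod hNW, separation (`¬ InPointClass`, `¬ OnHyperLine`, `¬ InScaleClass` by tree names) — this is the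
ONLY part importing `Summits.Schanuel.Schanuel.Theses.RootDecomp1E` (+ `…RootDecomp1EPointTransfer03`, `…RootDecomp1EScaleTransfer03` for the separation), 09 = §5b
(v2, fact-free; critic L1776 (i): additive no-credit addendum the port may pick up) `linSub` / `algebraicIndependent_linear_pair` / `rat_relation_of_colinear` /
`ih_of_two_scales` / `zTS_ih` + `item31409_applied_at_zTS'` (the item the ONLY hypothesis) / `item31409_instance_at_zTS'`. PORT EDITS: §6 PROBES (F0–F3:
`example`s and `#guard_msgs` axiom guards) NOT ported (HOME-only, as for ScaleTransfer/PointTransfer); `set_option linter.dupNamespace false` dropped; five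
one-line docstrings added; `succ_le_add_one'` / `gauss_mem_acl` private; statements and proofs otherwise verbatim. PRECISION (critic L1776): `InTwoScaleClass`
admits β of any degree ≥ 2, but the plane (T, βT, σ, βσ) is E-STABLE only for quadratic β; for deg β ≥ 3 those members are PLAIN (31410's scope at n = 4),
still decided by the 25020 cell. `--supports stmt-Schanuel-31409`; no census credit carried by the port; nothing here proves Schanuel; rung 0.
The lens's header follows.
-/

/-!
# RootDecomp1E — lens 2 (structural dichotomy special / generic), generation 37: «TWO-SCALE E-PLANES»
# Items 25020 (`DefectOneSchanuel`, S⁻) and 31409 (`EStableDefectOne`, first open length `n = 4`) of route 1E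
# DECIDED on the planes `z = (T, βT, σ, βσ)` — `T` a COVERED log-quartic tower, `σ` a log-power Liouville real,
# `β ∈ ℚ̄ ∖ ℚ` — modulo Nesterenko–Waldschmidt 1996 Theorem 1 ONLY (draft node file; memo NODE-g37.md)

Route of record `route-Schanuel-RootDecomp1E` (DRAFT rev 25, cap 15/15; `closes (hD : DefectOneSchanuel)
(hC : ClosedFormAtomSchanuel) … (hF : FreeDarkAtomSchanuel) : Schanuel`).  Critic's standing target E-R17
(STATUS L1667; checklist E-g37, L1703): a decided cell of 31409 at `n = 4` / of 25020 whose scale datum is NOT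
of (any) exponential Liouville type, obtained from a MEASURED transcendental anchor — (T3) + (T2).

## Input (tree, by FQ name)
`Literature.NumberTheory.Transcendental.NesterenkoWaldschmidt1996_thm_1` (file
`Literature/NumberTheory/Transcendental/ExpLogSimultaneousApproximationMeasure.lean`): NW96 Theorem 1, the
simultaneous approximation measure `|e^θ − α| + |θ − β| ≥ exp(−211·D·(log B + log log A + 4 log D +
2 log(E|θ|₊) + 10)·(D log A + 2E|θ| + 6 log E)·(3.3 D log(D+2) + log E)·(log E)⁻²)` — a registered NAMED FACT
(not tree-proved), carried as `(hNW : NesterenkoWaldschmidt1996_thm_1)` exactly as the credited 1K cells carry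
it; consumed through the tree's `RootDecomp1KGeneric.expPair_lower_bound_deg_height` (Generic17).  Nothing else.

## Mechanism (NEW on this route): a TRANSCENDENCE-TYPE MEASURE for `(T, e^T)` at COVERED TOWERS `T`, and a
## Liouville KERNEL one level up (relation level), giving THREE algebraically independent numbers `σ, T, e^T`

* §1–§2  The anchor class `CoveredTower T`: from some `N₀` on, EVERY scale `X` carries a rational `r` with
  `X ≤ den r`, `log den r ≤ 4 log⁴ X`, `|T − r| ≤ exp(−log³ den r)` — good rational approximations at EVERY
  scale, of quality polynomial in `log den`.  Explicit member `P_4 = Σ_k 2^{−2^{4^k}}` (`ptower 4`; exponents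
  `a_{k+1} = a_k⁴`, a POLYNOMIAL recursion): `coveredTower_ptower_four`.  Such `T` are NOT Liouville of
  exponential type: `not_liouvilleOrder_one_ptower`, `not_hyperLiouville_ptower` (lens 1 / lens 6 / g36 scales
  all are).  The second-scale class `LogPowLiouville p σ` (`|σ − r| < exp(−m·log^p den r)` for every `m`):
  `logPowLiouville_ptower : p + 1 ≤ d → LogPowLiouville p (ptower d)`; `logPowLiouville_two_iff` = tree `LogSqLiouville`.
* §3  (E2) `towerPair_measure` — for `T ≠ 0` covered, every length `K` and degree `D` there is `C > 0` with
  `‖Σ_{k ≤ K} G_k(T) e^{kT}‖ ≥ exp(−C·(1 + log relLen G)^18)` for all `G_0 … G_K ∈ ℤ[X]`, `G_K ≠ 0`, `deg G_k ≤ D`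
  (`relLen` = the tree's relative length Σ len G_k): `(T, e^T)` has a transcendence measure POLYNOMIAL IN THE
  LOG-HEIGHT at fixed degree (exponent 18), `T` QUANTIFIED over the class.  Proof: at the scale dictated by
  `relLen G` pick the covering rational `r`; `aeval_ne_zero_of_len_lt_den` (`den r > len G_K ⇒ G_K(r) ≠ 0`) keeps the
  top coefficient alive, the resultant-free ROOT PACKAGE (`root_package_eps`) + the Lipschitz slice
  (`lipschitz_sliceAt`) produce an algebraic `y` of degree `≤ K`, controlled height, with `‖e^r − y‖` tiny; NW96 at
  `(θ, α, β) = (r, y, r)` (`pair_lower_bound`) clashes (`clash_at_scale`).  Level `K = 0` is FACT-FREE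
  (`const_term_lower_bound`), whence the disjunction `(hNW : K = 0 ∨ NesterenkoWaldschmidt1996_thm_1)`.
* §4  KERNEL `kernel_sum_ne_zero`: a family measure `FamMeasure ρ w e K` (exponent `e ≥ 1`, all lengths `≤ K`)
  and a scale `σ` with `LogPowLiouville (e + 1) σ` kill every two-level relation `Σ_j σ^j Σ_k G_{jk}(ρ) w^k = 0`
  (substitute the approximant of `σ`, clear `den^J`: the Liouville error beats the measure because the measure is
  polynomial in `log height`).  Two-level extraction `exists_int_relation₂` (¬ a.i. `(a, b, c)` with `(b, c)` a.i. ⇒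
  such a relation) ⇒ (E3) `algebraicIndependent_two_scale (hNW) : CoveredTower T → T ≠ 0 → LogPowLiouville 19 σ →
  AlgebraicIndependent ℚ ![σ, T, cexp T]`, and FACT-FREE `algebraicIndependent_tower_sigma : … ![T, σ]`.
* §5  CELLS.  `InTwoScaleClass z := ∃ T σ β, CoveredTower T ∧ T ≠ 0 ∧ LogPowLiouville 19 σ ∧ IsAlgebraic ℚ β ∧
  β ∉ ℚ ∧ z = ![T, βT, σ, βσ]`; `defectOneSchanuel_twoScaleCell` (25020 at `n = 4`) and
  `eStableDefectOne_twoScaleCell` (31409 at `n = 4`; binders VERBATIM, E-stability and first-failure binders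
  carried unused): conclusion EXACTLY `((4 : ℕ) : Cardinal) ≤ trdeg ℚ(z, e^z) + 1`; positional links `…_of_item`.
  `SB 4 z` (S itself) is NOT obtained.  MEMBER `z_TS = (T₀, iT₀, σ₀, iσ₀)`, `T₀ = P_4`, `σ₀ = P_20` (`β = i` —
  item 31409's own «why it might fail» shape, the Gaussian plane): HYPOTHESIS-FREE `zTS_linearIndependent`,
  `zTS_eStable`, `zTS_inTwoScaleClass`, `algebraicIndependent_T₀σ₀`, `linearIndependent_T₀σ₀_acl` (free over ℚ̄);
  LIVE items APPLIED `item31409_applied_at_zTS` (IH binder CARRIED as `hIH`), `item25020_applied_at_zTS`, and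
  DISCHARGED `item31409_instance_at_zTS`, `item25020_instance_at_zTS : 4 ≤ trdeg ℚ(z_TS, e^{z_TS}) + 1` (mod hNW
  only).  §5b DISCHARGES the IH binder itself, fact-free (`zTS_ih`, from the a.i. of `(T₀, σ₀)` over ℚ̄ by a
  `ℚ(i)`-linear change of variables `algebraicIndependent_linear_pair` and `rat_relation_of_colinear`):
  `item31409_applied_at_zTS'` (the item the ONLY hypothesis), `item31409_instance_at_zTS'` (mod hNW ONLY).  SEPARATION (hypothesis-free): `zTS_not_inPointClass` (g36, tree `RootDecomp1EPointTransfer03`),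
  `zTS_not_onHyperLine`, `zTS_not_inScaleClass` (g35, tree `RootDecomp1EScaleTransfer03`) — a homogeneous tuple
  `ξ·y`, `y ∈ ℚ̄ⁿ`, has algebraic coordinate ratios, `T₀/σ₀ ∉ ℚ̄`; and by order: `not_hyperLiouville_T₀/σ₀`,
  `not_liouvilleOrder_one_T₀/σ₀`.
* §6  PROBES: LIVE item texts by `Iff.rfl`, class read-outs, the fact by FQ name (`rfl`), engine restated
  standalone, `#print axioms` guards (standard triple) on 20 declarations.

Nothing here proves Schanuel's conjecture; rung 0.  All statements over tree declarations (`len`, `relLen`,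
`sliceAt`, `LiouvilleOrder`, `HyperLiouville`, `cNW₂`, `expPair_lower_bound_deg_height`, the 1E route decls).
-/

noncomputable section

open Complex Polynomial IntermediateField Filter

namespace Summit.Schanuel.Schanuel.Theorems.RootDecomp1ETwoScale

open Summit.Schanuel.Schanuel.Theorems.RootDecomp1KHyper
open Summit.Schanuel.Schanuel.Theorems.RootDecomp1KHyper.HyperCell
open Summit.Schanuel.Schanuel.Theorems.RootDecomp1KGeneric
open Literature.NumberTheory.Transcendental (NesterenkoWaldschmidt1996_thm_1 weilHeight₁)

variable {K : ℕ}

/-! ## §1  The poly-log towers `P_d = Σ_k 2^{−a_k}`, `a_k = 2^{d^k}` (`a_{k+1} = a_k^d`) -/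

/-- The exponents `a_k = 2^{d^k}`; POLYNOMIAL recursion `a_{k+1} = a_k^d` (lens 6's `λ_H`: `a_{k+1} = 2^{(k+1)a_k}`;
lens 1's `T_c`: `a_{k+1} = 2^{c a_k}` — both EXPONENTIAL recursions, i.e. reals of (every / finite) exponential order). -/
def pexp (d : ℕ) : ℕ → ℕ
  | 0 => 2
  | k + 1 => pexp d k ^ d

/-- `a₀ = 2`. -/
@[simp] theorem pexp_zero (d : ℕ) : pexp d 0 = 2 := rfl

/-- `a_{k+1} = a_k^d`. -/
theorem pexp_succ (d k : ℕ) : pexp d (k + 1) = pexp d k ^ d := rfl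

/-- `2 ≤ a_k` (`d ≥ 1`). -/
theorem two_le_pexp {d : ℕ} (hd : 1 ≤ d) (k : ℕ) : 2 ≤ pexp d k := by
  induction k with
  | zero => simp
  | succ k ih =>
      rw [pexp_succ]
      calc 2 ≤ pexp d k := ih
        _ = pexp d k ^ 1 := (pow_one _).symm
        _ ≤ pexp d k ^ d := Nat.pow_le_pow_right (by omega) hd

/-- `1 ≤ a_k` (`d ≥ 1`). -/
theorem one_le_pexp {d : ℕ} (hd : 1 ≤ d) (k : ℕ) : 1 ≤ pexp d k := le_trans (by norm_num) (two_le_pexp hd k)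

/-- `a_k < a_{k+1}` (`d ≥ 2`). -/
theorem pexp_lt_succ {d : ℕ} (hd : 2 ≤ d) (k : ℕ) : pexp d k < pexp d (k + 1) := by
  rw [pexp_succ]
  have h2 := two_le_pexp (d := d) (by omega) k
  calc pexp d k = pexp d k ^ 1 := (pow_one _).symm
    _ < pexp d k ^ d := Nat.pow_lt_pow_right (by omega) (by omega)

/-- `k + 1 ≤ a_k` (`d ≥ 2`). -/
theorem succ_le_pexp {d : ℕ} (hd : 2 ≤ d) (k : ℕ) : k + 1 ≤ pexp d k := by
  induction k with
  | zero => simp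
  | succ k ih => exact Nat.succ_le_of_lt (lt_of_le_of_lt ih (pexp_lt_succ hd k))

/-- `a_K + j ≤ a_{K+j}` (`d ≥ 2`). -/
theorem pexp_add_le {d : ℕ} (hd : 2 ≤ d) (K j : ℕ) : pexp d K + j ≤ pexp d (K + j) := by
  induction j with
  | zero => simp
  | succ j ih =>
      have := pexp_lt_succ hd (K + j)
      show pexp d K + (j + 1) ≤ pexp d (K + j + 1)
      omega

/-- `pexp d` is strictly monotone (`d ≥ 2`). -/
theorem pexp_strictMono {d : ℕ} (hd : 2 ≤ d) : StrictMono (pexp d) :=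
  strictMono_nat_of_lt_succ (pexp_lt_succ hd)

/-- **`P_d`** — the poly-log tower number `Σ_k 2^{−a_k}`, `a_k = 2^{d^k}`. -/
def ptower (d : ℕ) : ℝ := ∑' k, 1 / (2 : ℝ) ^ pexp d k

/-- The defining series is summable. -/
theorem summable_ptower {d : ℕ} (hd : 2 ≤ d) : Summable fun k => 1 / (2 : ℝ) ^ pexp d k :=
  summable_one_div_pow_of_le (by norm_num) fun k => (Nat.le_succ k).trans (succ_le_pexp hd k)

/-- Partial sums `Σ_{k ≤ K} 2^{−a_k} = M / 2^{a_K}` with `M` ODD. -/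
theorem ptower_partialSum {d : ℕ} (hd : 2 ≤ d) (K : ℕ) :
    ∃ M : ℕ, Odd M ∧ ∑ k ∈ Finset.range (K + 1), 1 / (2 : ℝ) ^ pexp d k = M / (2 : ℝ) ^ pexp d K := by
  induction K with
  | zero => exact ⟨1, odd_one, by simp⟩
  | succ K ih =>
      obtain ⟨M, hM, hsum⟩ := ih
      have hlt := pexp_lt_succ hd K
      refine ⟨M * 2 ^ (pexp d (K + 1) - pexp d K) + 1, ?_, ?_⟩
      · refine Even.add_one (Even.mul_left ?_ _)
        exact (Nat.even_pow' (by omega)).mpr (by decide)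
      · rw [Finset.sum_range_succ, hsum]
        have h2 : (2 : ℝ) ^ pexp d (K + 1) = 2 ^ pexp d K * 2 ^ (pexp d (K + 1) - pexp d K) := by
          rw [← pow_add, Nat.add_sub_cancel' hlt.le]
        rw [div_add_div _ _ (by positivity) (by positivity), div_eq_div_iff (by positivity)
          (by positivity)]
        push_cast
        rw [h2]
        ring

/-- The tail `Σ_{k ≥ K} 2^{−a_k}` is positive … -/
theorem ptower_tail_pos {d : ℕ} (hd : 2 ≤ d) (K : ℕ) :
    0 < ∑' k, 1 / (2 : ℝ) ^ pexp d (k + K) :=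
  ((summable_nat_add_iff K).mpr (summable_ptower hd)).tsum_pos (fun _ => by positivity) 0
    (by positivity)

/-- … at most `2 · 2^{−a_K}` … -/
theorem ptower_tail_le {d : ℕ} (hd : 2 ≤ d) (K : ℕ) :
    ∑' k, 1 / (2 : ℝ) ^ pexp d (k + K) ≤ 2 * (1 / (2 : ℝ) ^ pexp d K) := by
  have hgeom : Summable fun k : ℕ => ((1 : ℝ) / 2) ^ k * (1 / (2 : ℝ) ^ pexp d K) :=
    (summable_geometric_two).mul_right _
  calc ∑' k, 1 / (2 : ℝ) ^ pexp d (k + K)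
        ≤ ∑' k : ℕ, ((1 : ℝ) / 2) ^ k * (1 / (2 : ℝ) ^ pexp d K) := by
        refine Summable.tsum_le_tsum (fun k => ?_)
          ((summable_nat_add_iff K).mpr (summable_ptower hd)) hgeom
        have hle : pexp d K + k ≤ pexp d (k + K) := by
          rw [Nat.add_comm k K]; exact pexp_add_le hd K k
        rw [one_div_pow, one_div_mul_one_div, ← pow_add, Nat.add_comm k (pexp d K)]
        exact one_div_pow_le_one_div_pow_of_le (by norm_num) hle
    _ = 2 * (1 / (2 : ℝ) ^ pexp d K) := by rw [tsum_mul_right, tsum_geometric_two]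

/-- … and at least its first term `2^{−a_K}`. -/
theorem ptower_tail_ge {d : ℕ} (hd : 2 ≤ d) (K : ℕ) :
    1 / (2 : ℝ) ^ pexp d K ≤ ∑' k, 1 / (2 : ℝ) ^ pexp d (k + K) := by
  have h := ((summable_nat_add_iff K).mpr (summable_ptower hd)).le_tsum 0 (fun j _ => by positivity)
  simpa using h

/-- `P_d` = partial sum + tail. -/
theorem ptower_eq_partialSum_add_tail {d : ℕ} (hd : 2 ≤ d) (K : ℕ) :
    ptower d = ∑ k ∈ Finset.range K, 1 / (2 : ℝ) ^ pexp d k + ∑' k, 1 / (2 : ℝ) ^ pexp d (k + K) :=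
  ((summable_ptower hd).sum_add_tsum_nat_add K).symm

/-- `1/4 < P_d` (first term). -/
theorem quarter_lt_ptower {d : ℕ} (hd : 2 ≤ d) : (1 : ℝ) / 4 < ptower d := by
  rw [ptower_eq_partialSum_add_tail hd 1]
  have h1 : ∑ k ∈ Finset.range 1, 1 / (2 : ℝ) ^ pexp d k = 1 / 4 := by simp; norm_num
  rw [h1]
  linarith [ptower_tail_pos hd 1]

/-- `P_d` is positive, hence non-zero. -/
theorem ptower_pos {d : ℕ} (hd : 2 ≤ d) : 0 < ptower d := lt_trans (by norm_num) (quarter_lt_ptower hd)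

/-- `P_d ≤ 1`. -/
theorem ptower_le_one {d : ℕ} (hd : 2 ≤ d) : ptower d ≤ 1 := by
  rw [ptower_eq_partialSum_add_tail hd 1]
  have h1 : ∑ k ∈ Finset.range 1, 1 / (2 : ℝ) ^ pexp d k = 1 / 4 := by simp; norm_num
  rw [h1]
  have h2 := ptower_tail_le hd 1
  have h3 : (2 : ℝ) ^ 2 ≤ (2 : ℝ) ^ pexp d 1 := pow_le_pow_right₀ (by norm_num) (succ_le_pexp hd 1)
  have h4 : 2 * (1 / (2 : ℝ) ^ pexp d 1) ≤ 2 * (1 / (2 : ℝ) ^ 2) := by gcongr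
  linarith

/-- **The truncations** `s_K = M/2^{a_K}` (`M` odd): denominator EXACTLY `Q_K = 2^{a_K}`, and the error is the
tail: `2^{−a_{K+1}} ≤ P_d − s_K ≤ 2·2^{−a_{K+1}}`. -/
theorem ptower_truncation {d : ℕ} (hd : 2 ≤ d) (K : ℕ) :
    ∃ r : ℚ, r.den = 2 ^ pexp d K ∧
      1 / (2 : ℝ) ^ pexp d (K + 1) ≤ ptower d - r ∧ ptower d - r ≤ 2 * (1 / (2 : ℝ) ^ pexp d (K + 1)) := by
  obtain ⟨M, hModd, hsum⟩ := ptower_partialSum hd K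
  set A : ℕ := pexp d K with hA
  set r : ℚ := (M : ℚ) / ((2 : ℚ) ^ A) with hr
  have hden : r.den = 2 ^ A := by
    have hcop : Nat.Coprime (M : ℤ).natAbs ((2 : ℤ) ^ A).natAbs := by
      rw [Int.natAbs_natCast, Int.natAbs_pow]
      exact Nat.Coprime.pow_right A (Nat.coprime_two_right.mpr hModd)
    have h := Rat.den_div_eq_of_coprime (a := (M : ℤ)) (b := (2 : ℤ) ^ A) (by positivity) hcop
    have e : ((M : ℤ) : ℚ) / (((2 : ℤ) ^ A : ℤ) : ℚ) = r := by rw [hr]; push_cast; rfl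
    rw [e] at h
    exact_mod_cast h
  have hrR : (r : ℝ) = ∑ k ∈ Finset.range (K + 1), 1 / (2 : ℝ) ^ pexp d k := by
    rw [hsum, hr]; push_cast; rfl
  have htail : ptower d - r = ∑' k, 1 / (2 : ℝ) ^ pexp d (k + (K + 1)) := by
    rw [hrR, ptower_eq_partialSum_add_tail hd (K + 1)]; ring
  refine ⟨r, hden, ?_, ?_⟩
  · rw [htail]; exact ptower_tail_ge hd (K + 1)
  · rw [htail]; exact ptower_tail_le hd (K + 1)

end Summit.Schanuel.Schanuel.Theorems.RootDecomp1ETwoScale
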